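import Literature.AnabelianGeometry.SemiGraphs.TemperedReconstructionR0Refutation
import Literature.AnabelianGeometry.SemiGraphs.TemperedReconstructionCor39AsymmetricLocallyFinite
import HarnessLib

/-!
# [SemiAnbd] Corollary 3.9 (a), up to twist: Thm. 3.7 (iii) at the SOURCE is NECESSARY — the locally
# finite cell of Cor. 3.9 is sharp on both sides (row «COR39a@SOURCE-(CE)-NECESSARY»)

Mochizuki, *Semi-graphs of anabelioids*, Publ. RIMS **42** (2006), §3, Corollary 3.9 and its proof,
manuscript pp. 42–43 (p. 42: "whose quasi-geometricity follows by 'substituting' the equivalences of Theorem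
3.7, (iv), into Definition 3.8") [cite: MochizukiSemiAnbd2006, Cor 3.9 pp.42-43].

PROOF-ONLY file (abc-iut cell, layer L3, seat abc-iut-L3-t10 gen 10; 0 definitions, no named fact; LF-SGA
cell F-1710 / F-2771; inputs BY NAME: abc-iut-w6-d099 p467529, this lineage p493838 / p493595).  The
asymmetric locally finite cell (`cor39UpToTwistAt_asymmetric_of_isLocallyFinite`, p493838) reads, at a pair
`(G, H)` of locally finite Cor-3.9 graphs of anabelioids: (CE) «every compact element of `π₁^temp` is
verticial» (= Thm. 3.7 (iii) at a locally finite graph) AT THE SOURCE gives clause (a) — a homomorphism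
induced up to twist by a locally open `F : G → H` is compatibly quasi-geometric —, (CE) AT THE TARGET gives
clause (b); for (b) the target-side input is necessary (`not_forall_isLocallyFinite_cor39b`, p493595).  This
file settles the question left open there («(CE) at the source for (a): undecided, no witness known»): **the
source-side input of (a) is NECESSARY too, and cannot be traded for any hypothesis at the target.**

THE WITNESS is abc-iut-w6-d099's refutation pair of the ∀-form of step (R0) (`not_inducedIsQuasiGeometric`,
`TemperedReconstructionR0Refutation.lean`, p467529), read AT the pair: source `𝒢_θ(p, n)` (abc-iut-L3-d1;
LOCALLY FINITE, Cor-3.9 hypotheses, with an ABELIAN maximal compact subgroup `ζ(ℤ_p)` of `π₁^temp` in no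
verticial subgroup — abc-iut-f-175 / abc-iut-L3-d4); target the Iwahori loop `loopGraph p` (abc-iut-w5-d236;
FINITE, so Thm. 3.7 (iii), (CE) and local finiteness all hold there); `F :=` the ALTERNATING FOLD (locally
open; `p` odd, `n ≥ 1`); `φ :=` the homomorphism INDUCED by `F` (Prop. 3.6 (iv), `inducedHomOfMorphism_induces`:
induced for the chosen conjugator family, hence up to twist, and compatible with `F` on verticial and edge
homomorphisms); and `φ` is NOT quasi-geometric (`not_isQuasiGeometric_loopGraph_of_abelian_maximalCompact`) —
indeed no continuous `π₁^temp(𝒢_θ) → π₁^temp(loopGraph p)` is.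

CONTENTS: §1 the pair — no `φ` is quasi-geometric; the witness; ★ `thetaRayFreeProP_not_cor39a_and_cor39b_loopGraph`
((a) FAILS at the pair, (b) holds vacuously).  §2 the ¬∀ forms — ★ `not_forall_isLocallyFinite_induces_isQuasiGeometric`
(strongest shape: locally finite source, FINITE target, `Hom.Induces`, literal `IsQuasiGeometric`);
★ `not_forall_isLocallyFinite_cor39a` (named currencies, WITH `CompactInVerticialAt` at the target) against
`forall_compactInVerticialAt_source_cor39a_of_isLocallyFinite_target` (same shape, PROVED = p493838);
`not_forall_isLocallyFinite_cor39a_of_forall_mem_target` ((CE) cannot move to the target in p493838's (a)-half).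
§3 ★ `cor39UpToTwist_isLocallyFinite_cell_sharp` — each clause needs Thm. 3.7 (iii) on ITS OWN side only.

HONEST FRAMING: OUR rendering at OUR typed objects (∀-countable typing; the witnesses are infinite graphs of
anabelioids where «maximal compact = verticial» fails); outside the [IUTchIII] Cor. 3.12 cone — every print
consumer of Cor. 3.9 has a finite dual graph, where clause (a) is a theorem of the finite files
(`cor39CompatUpToTwistAt_of_finite`); Cor. 3.9 as printed and as used is not claimed false; nothing asserts
abc proved or refuted; no side is taken on [IUTchIII] Cor. 3.12; typed ≠ proved.
-/

open CategoryTheory Topology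

namespace Literature.AnabelianGeometry.SemiGraphs

namespace ProfiniteSemiGraph

universe u

section ThetaRayFold  -- §1. The fold pair `(𝒢_θ(p, n), loopGraph p)`

variable (p : ℕ) [hp : Fact p.Prime] (n : ℕ → ℕ)

/-- **At the pair (`𝒢_θ(p, n)`, `loopGraph p`) NO continuous `π₁^temp(𝒢_θ) → π₁^temp(loopGraph p)` is
quasi-geometric** (canonical source chart, every target chart; `k ≤ n_k`): the escaping ABELIAN maximal compact
`ζ(ℤ_p)` of `π₁^temp(𝒢_θ)` (abc-iut-f-175) would go onto an open subgroup of a copy of `P = ℤ_p ⋊ (1 + pℤ_p)`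
(Thm. 3.7 (iv), (i) at the finite target), which has none abelian (abc-iut-w6-d099). [cite: MochizukiSemiAnbd2006, Def 3.8 p.42] -/
theorem thetaRayFreeProP_forall_not_isQuasiGeometric_loopGraph (hn : ∀ k, k ≤ n k) :
    ∃ h36 : (thetaRayFreeProP p n).Prop36Hypotheses,
      ∀ (cℋ : TemperedPiChart (IwahoriWitness.loopGraph p))
        (φ : ((thetaRayFreeProP p n).temperedPiChart h36).G →ₜ* cℋ.G), ¬ IsQuasiGeometric φ := by
  obtain ⟨h36, ζ, -, hmax, -⟩ := thetaRayFreeProP_exists_maximalCompact_escaping p n hn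
  exact ⟨h36, fun cℋ φ => not_isQuasiGeometric_loopGraph_of_abelian_maximalCompact p ζ.toMonoidHom hmax cℋ φ⟩

/-- **The witness pair for Cor. 3.9 (a)**: at (`𝒢_θ(p, n)`, `loopGraph p`), `p` odd, `1 ≤ n_k`, `k ≤ n_k`
(canonical source chart, every target chart), the ALTERNATING FOLD `F` (abc-iut-w6-d099, locally open) and the
homomorphism `φ` INDUCED by `F` (Prop. 3.6 (iv); induced for the chosen conjugator family, hence up to twist;
compatible with `F` on verticial and edge homomorphisms) — and `φ` is NOT quasi-geometric.
[cite: MochizukiSemiAnbd2006, Cor 3.9 p.42] -/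
theorem thetaRayFreeProP_exists_induces_not_isQuasiGeometric_loopGraph (hp2 : p ≠ 2) (hn₁ : ∀ k, 1 ≤ n k)
    (hn : ∀ k, k ≤ n k) :
    ∃ h36 : (thetaRayFreeProP p n).Prop36Hypotheses,
      ∀ cℋ : TemperedPiChart (IwahoriWitness.loopGraph p),
        ∃ (F : Hom (thetaRayFreeProP p n) (IwahoriWitness.loopGraph p))
          (φ : ((thetaRayFreeProP p n).temperedPiChart h36).G →ₜ* cℋ.G),
          F.IsLocallyOpen ∧ F.Induces _ cℋ φ ∧ F.InducesUpToTwist _ cℋ φ ∧ F.CompatV _ cℋ φ ∧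
            F.CompatE _ cℋ φ ∧ ¬ IsQuasiGeometric φ := by
  obtain ⟨h36, hno⟩ := thetaRayFreeProP_forall_not_isQuasiGeometric_loopGraph p n hn
  refine ⟨h36, fun cℋ => ?_⟩
  obtain ⟨F, hF⟩ := exists_isLocallyOpen_hom_thetaRayFreeProP_loopGraph p n hp2 hn₁
  obtain ⟨φ, hind, hV, hE, -⟩ := inducedHomOfMorphism_induces h36
    (IwahoriWitness.loopGraph_cor39Hypotheses p).toProp36Hypotheses F
    ((thetaRayFreeProP p n).temperedPiChart h36) cℋ
  exact ⟨F, φ, hF, hind, F.inducesUpToTwist_of_induces _ cℋ φ hind, hV, hE, hno cℋ φ⟩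

/-- ★ **At the pair (`𝒢_θ(p, n)`, `loopGraph p`) clause (a) of [SemiAnbd] Cor. 3.9 up to twist FAILS
while clause (b) HOLDS (vacuously)** (`p` odd, `1 ≤ n_k`, `k ≤ n_k`; canonical source chart, every target
chart): NOT every homomorphism induced up to twist by a locally open `𝒢_θ(p, n) → loopGraph p` is compatibly
quasi-geometric — the target is FINITE (Thm. 3.7 (iii)/(iv), (CE), locally finite), but Thm. 3.7 (iii) fails
at the locally finite SOURCE, and that is what (a) needs —; and every compatibly quasi-geometric `φ` is induced
up to twist, uniquely on underlying semi-graphs, because there is none. [cite: MochizukiSemiAnbd2006, Cor 3.9 p.42] -/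
theorem thetaRayFreeProP_not_cor39a_and_cor39b_loopGraph (hp2 : p ≠ 2) (hn₁ : ∀ k, 1 ≤ n k)
    (hn : ∀ k, k ≤ n k) :
    ∃ h36 : (thetaRayFreeProP p n).Prop36Hypotheses,
      ∀ cℋ : TemperedPiChart (IwahoriWitness.loopGraph p),
        (¬ ∀ (F : Hom (thetaRayFreeProP p n) (IwahoriWitness.loopGraph p)), F.IsLocallyOpen →
            ∀ φ : ((thetaRayFreeProP p n).temperedPiChart h36).G →ₜ* cℋ.G, F.InducesUpToTwist _ cℋ φ →
              IsCompatiblyQuasiGeometric φ) ∧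
        ∀ φ : ((thetaRayFreeProP p n).temperedPiChart h36).G →ₜ* cℋ.G, IsCompatiblyQuasiGeometric φ →
          ∃ F : Hom (thetaRayFreeProP p n) (IwahoriWitness.loopGraph p), F.IsLocallyOpen ∧
            F.InducesUpToTwist _ cℋ φ ∧
            ∀ F' : Hom (thetaRayFreeProP p n) (IwahoriWitness.loopGraph p), F'.IsLocallyOpen →
              F'.InducesUpToTwist _ cℋ φ → F'.base = F.base := by
  obtain ⟨h36, hw⟩ := thetaRayFreeProP_exists_induces_not_isQuasiGeometric_loopGraph p n hp2 hn₁ hn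
  obtain ⟨h36', hno⟩ := thetaRayFreeProP_forall_not_isQuasiGeometric_loopGraph p n hn
  refine ⟨h36, fun cℋ => ⟨fun ha => ?_, fun φ hφ => absurd hφ.isQuasiGeometric (hno cℋ φ)⟩⟩
  obtain ⟨F, φ, hF, -, hind, -, -, hnq⟩ := hw cℋ
  exact hnq (ha F hF φ hind).isQuasiGeometric

end ThetaRayFold

/-! ### 2. Thm. 3.7 (iii) at the SOURCE is necessary for clause (a) -/

/-- ★ **The strongest shape.**  It is FALSE that at every pair (`G` a LOCALLY FINITE Cor-3.9 graph of
anabelioids, `H` a FINITE one — so Thm. 3.7 (iii)/(iv), (CE) and local finiteness all hold at `H`) every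
homomorphism INDUCED (frozen chosen-family sense) by a LOCALLY OPEN morphism `G → H` is quasi-geometric in the
literal sense of Def. 3.8 (witness (`𝒢_θ(3, k ↦ k+1)`, `loopGraph 3`, alternating fold, induced `φ`)): print's
"substituting the equivalences of Theorem 3.7, (iv), into Definition 3.8" uses (iv) AT THE SOURCE, and that use
is load-bearing. [cite: MochizukiSemiAnbd2006, Cor 3.9 p.42] -/
theorem not_forall_isLocallyFinite_induces_isQuasiGeometric :
    ¬ ∀ (𝒢 ℋ : ProfiniteSemiGraph.{0}), 𝒢.graph.IsLocallyFinite → ℋ.graph.IsFinite →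
        Cor39Hypotheses 𝒢 → Cor39Hypotheses ℋ →
        ∀ (c𝒢 : TemperedPiChart 𝒢) (cℋ : TemperedPiChart ℋ) (F : Hom 𝒢 ℋ), F.IsLocallyOpen →
          ∀ φ : c𝒢.G →ₜ* cℋ.G, F.Induces c𝒢 cℋ φ → IsQuasiGeometric φ := by
  intro h
  haveI : Fact (Nat.Prime 3) := ⟨Nat.prime_three⟩
  have hℋ : Cor39Hypotheses (IwahoriWitness.loopGraph 3) := IwahoriWitness.loopGraph_cor39Hypotheses 3
  obtain ⟨h36, hw⟩ := thetaRayFreeProP_exists_induces_not_isQuasiGeometric_loopGraph 3 (fun k => k + 1)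
    (by decide) (fun k => Nat.succ_pos k) (fun k => Nat.le_succ k)
  obtain ⟨F, φ, hF, hind, -, -, -, hnq⟩ := hw ((IwahoriWitness.loopGraph 3).temperedPiChart hℋ.toProp36Hypotheses)
  exact hnq (h _ _ SemiGraph.ray_isLocallyFinite (IwahoriWitness.loopGraph_isFinite 3)
    (thetaRayFreeProP_cor39Hypotheses 3 _) hℋ _ _ F hF φ hind)

/-- ★ **Thm. 3.7 (iii) at the SOURCE cannot be weakened to local finiteness — clause (a) of [SemiAnbd]
Cor. 3.9 up to twist** (currencies `Hom.InducesUpToTwist` / `IsCompatiblyQuasiGeometric` of abc-iut-w4-d080's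
`Cor39CompatUpToTwist`): it is FALSE that at every pair of LOCALLY FINITE Cor-3.9 graphs WITH Thm. 3.7 (iii)
(`CompactInVerticialAt`) at the TARGET every homomorphism induced up to twist by a locally open morphism is
compatibly quasi-geometric (witness pair (`𝒢_θ(3, k ↦ k+1)`, `loopGraph 3`), the fold).  So in
`cor39a_upToTwistAt_of_isLocallyFinite_target` the input `CompactInVerticialAt 𝒢` is load-bearing, exactly as
`CompactInVerticialAt ℋ` is for (b) (`not_forall_isLocallyFinite_cor39b`). [cite: MochizukiSemiAnbd2006, Cor 3.9 pp.42-43] -/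
theorem not_forall_isLocallyFinite_cor39a :
    ¬ ∀ (𝒢 ℋ : ProfiniteSemiGraph.{0}), 𝒢.graph.IsLocallyFinite → ℋ.graph.IsLocallyFinite →
        Cor39Hypotheses 𝒢 → Cor39Hypotheses ℋ → CompactInVerticialAt ℋ →
        ∀ (c𝒢 : TemperedPiChart 𝒢) (cℋ : TemperedPiChart ℋ) (F : Hom 𝒢 ℋ), F.IsLocallyOpen →
          ∀ φ : c𝒢.G →ₜ* cℋ.G, F.InducesUpToTwist c𝒢 cℋ φ → IsCompatiblyQuasiGeometric φ := by
  intro h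
  refine not_forall_isLocallyFinite_induces_isQuasiGeometric fun 𝒢 ℋ hlf𝒢 hfℋ h𝒢 hℋ c𝒢 cℋ F hF φ hind => ?_
  haveI : Finite ℋ.graph.Vertex := hfℋ.finite_vertex
  haveI : Finite ℋ.graph.Edge := hfℋ.finite_edge
  exact (h 𝒢 ℋ hlf𝒢 isLocallyFinite_of_finite_edge h𝒢 hℋ compactInVerticialAt_of_finiteGraph c𝒢 cℋ F hF φ
    (F.inducesUpToTwist_of_induces c𝒢 cℋ φ hind)).isQuasiGeometric

/-- **Contrast, same quantifier shape: with Thm. 3.7 (iii) at the SOURCE clause (a) HOLDS at every locally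
finite target** (`cor39a_upToTwistAt_of_isLocallyFinite_target`, p493838): SOURCE Thm. 3.7 (iii), TARGET
locally finite (nothing more). [cite: MochizukiSemiAnbd2006, Cor 3.9 pp.42-43] -/
theorem forall_compactInVerticialAt_source_cor39a_of_isLocallyFinite_target :
    ∀ (𝒢 ℋ : ProfiniteSemiGraph.{u}), CompactInVerticialAt 𝒢 → ℋ.graph.IsLocallyFinite →
        Cor39Hypotheses 𝒢 → Cor39Hypotheses ℋ →
        ∀ (c𝒢 : TemperedPiChart 𝒢) (cℋ : TemperedPiChart ℋ) (F : Hom 𝒢 ℋ), F.IsLocallyOpen →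
          ∀ φ : c𝒢.G →ₜ* cℋ.G, F.InducesUpToTwist c𝒢 cℋ φ → IsCompatiblyQuasiGeometric φ :=
  fun _ _ h𝒢iii hlfℋ h𝒢 hℋ c𝒢 cℋ F hF φ hind =>
    cor39a_upToTwistAt_of_isLocallyFinite_target h𝒢iii hlfℋ h𝒢 hℋ c𝒢 cℋ F hF φ hind

/-- **(CE) cannot be moved from the source to the target in the (a)-half of the asymmetric cell** (def-free
currency of `cor39UpToTwistAt_asymmetric_of_isLocallyFinite`, p493838): it is FALSE that at every pair of locally
finite Cor-3.9 graphs (CE) «every compact element is verticial» AT THE TARGET gives (a). [cite: MochizukiSemiAnbd2006, Cor 3.9 pp.42-43] -/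
theorem not_forall_isLocallyFinite_cor39a_of_forall_mem_target :
    ¬ ∀ (𝒢 ℋ : ProfiniteSemiGraph.{0}), 𝒢.graph.IsLocallyFinite → ℋ.graph.IsLocallyFinite →
        Cor39Hypotheses 𝒢 → Cor39Hypotheses ℋ → ∀ (c𝒢 : TemperedPiChart 𝒢) (cℋ : TemperedPiChart ℋ),
        (∀ (c : TemperedPiChart ℋ) (K : Subgroup c.G), IsCompact (K : Set c.G) →
            ∀ g ∈ K, ∃ (v : ℋ.graph.Vertex) (H : Subgroup c.G), H ∈ verticialSubgroups c v ∧ g ∈ H) →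
          ∀ (F : Hom 𝒢 ℋ), F.IsLocallyOpen → ∀ φ : c𝒢.G →ₜ* cℋ.G,
            (∃ θ : F.ConjugatorFamily, Nonempty (F.chartPullbackWith θ c𝒢 cℋ ≅ BTemp.res φ)) →
              IsCompatiblyQuasiGeometric φ := by
  intro h
  refine not_forall_isLocallyFinite_induces_isQuasiGeometric fun 𝒢 ℋ hlf𝒢 hfℋ h𝒢 hℋ c𝒢 cℋ F hF φ hind => ?_
  haveI : Finite ℋ.graph.Vertex := hfℋ.finite_vertex
  haveI : Finite ℋ.graph.Edge := hfℋ.finite_edge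
  exact (h 𝒢 ℋ hlf𝒢 isLocallyFinite_of_finite_edge h𝒢 hℋ c𝒢 cℋ
    (fun c K hK => forall_mem_exists_verticial_of_finiteGraph hℋ.thm37Hypotheses c K hK) F hF φ
    (F.inducesUpToTwist_of_induces c𝒢 cℋ φ hind)).isQuasiGeometric

/-! ### 3. The locally finite cell of Cor. 3.9 up to twist is sharp on both sides -/

open Literature.AnabelianGeometry.SemiGraphs.FreeProPRankTwo in
/-- **The (b)-necessity of p493595 with Thm. 3.7 (iii) at the SOURCE added to the refuted binder**: FALSE that
at every pair of locally finite Cor-3.9 graphs WITH `CompactInVerticialAt` at the SOURCE every compatibly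
quasi-geometric homomorphism is induced up to twist by a locally open morphism — abc-iut-f-175's witness
(`OneVertex.graph F̂₂⁽²⁾ → 𝒢_θ(2, k ↦ k+1)`, `φ = ζ ∘ χ_a`; p453900 / p454761) has a FINITE source. [cite: MochizukiSemiAnbd2006, Cor 3.9 pp.42-43] -/
theorem not_forall_isLocallyFinite_cor39b_of_compactInVerticialAt_source :
    ¬ ∀ (𝒢 ℋ : ProfiniteSemiGraph.{0}), 𝒢.graph.IsLocallyFinite → ℋ.graph.IsLocallyFinite →
        Cor39Hypotheses 𝒢 → Cor39Hypotheses ℋ → CompactInVerticialAt 𝒢 →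
        ∀ (c𝒢 : TemperedPiChart 𝒢) (cℋ : TemperedPiChart ℋ) (φ : c𝒢.G →ₜ* cℋ.G),
          IsCompatiblyQuasiGeometric φ → ∃ F : Hom 𝒢 ℋ, F.IsLocallyOpen ∧ F.InducesUpToTwist c𝒢 cℋ φ := by
  intro h
  haveI : Fact (Nat.Prime 2) := ⟨Nat.prime_two⟩
  obtain ⟨h36, ζ, h37, hmax, hnv⟩ :=
    thetaRayFreeProP_exists_maximalCompact_escaping 2 (fun k => k + 1) (fun k => Nat.le_succ k)
  obtain ⟨L⟩ := nonempty_levelFamily_grp 2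
  haveI : SecondCountableTopology (Grp 2) := secondCountableTopology_grp 2
  have hℋ : Cor39Hypotheses (thetaRayFreeProP 2 fun k => k + 1) := thetaRayFreeProP_cor39Hypotheses 2 _
  have h𝒢 : Cor39Hypotheses (OneVertex.graph (Grp 2)) :=
    ⟨OneVertex.prop36Hypotheses L (isSlimGroup 2), OneVertex.isTotallyEstranged, ⟨fun b => nomatch b⟩⟩
  have hlf𝒢 : (OneVertex.graph.{0} (Grp 2)).graph.IsLocallyFinite :=
    ⟨fun _ => Set.finite_empty.subset fun e _ => nomatch e⟩
  haveI : Finite (OneVertex.graph.{0} (Grp 2)).graph.Vertex := inferInstanceAs (Finite PUnit)  -- FINITE source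
  haveI : Finite (OneVertex.graph.{0} (Grp 2)).graph.Edge := inferInstanceAs (Finite PEmpty)
  have h𝒢iii : CompactInVerticialAt (OneVertex.graph.{0} (Grp 2)) := compactInVerticialAt_of_finiteGraph
  have hrange : (ζ.comp (χa 2)).toMonoidHom.range = ζ.toMonoidHom.range := by
    change (ζ.toMonoidHom.comp (χa 2).toMonoidHom).range = _
    rw [MonoidHom.range_comp, MonoidHom.range_eq_top.mpr (χa_surjective 2), ← MonoidHom.range_eq_map]
  have hmax' : IsMaximalCompactSubgroup (ζ.comp (χa 2)).toMonoidHom.range := by rw [hrange]; exact hmax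
  have hnv' : ¬ ∃ (v : ℕ) (H : Subgroup ((thetaRayFreeProP 2 fun k => k + 1).temperedPiChart h36).G),
      H ∈ verticialSubgroups ((thetaRayFreeProP 2 fun k => k + 1).temperedPiChart h36) v ∧
        (ζ.comp (χa 2)).toMonoidHom.range ≤ H := by
    rw [hrange]; exact hnv
  obtain ⟨F, -, hind⟩ := h (OneVertex.graph (Grp 2)) (thetaRayFreeProP 2 fun k => k + 1) hlf𝒢
    SemiGraph.ray_isLocallyFinite h𝒢 hℋ h𝒢iii (OneVertex.chart L) _ (ζ.comp (χa 2))
    (isCompatiblyQuasiGeometric_of_range_isMaximalCompactSubgroup (ζ.comp (χa 2)) hmax')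
  exact not_compatV_of_range_not_le L h37 _ (ζ.comp (χa 2)) hnv' F
    (F.compat_of_inducesUpToTwist (OneVertex.chart L) _ _ hind).1

/-- ★ **The locally finite cell of [SemiAnbd] Cor. 3.9 up to twist is SHARP.**  Over pairs of LOCALLY FINITE
Cor-3.9 graphs of anabelioids: clause (a) holds whenever Thm. 3.7 (iii) holds at the SOURCE
(`cor39a_upToTwistAt_of_isLocallyFinite_target`) and FAILS at some pair with (iii) at the target (first
conjunct; the fold `𝒢_θ(3, k ↦ k+1) → loopGraph 3`, abc-iut-w6-d099); clause (b) holds whenever (iii) holds at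
the TARGET (`cor39b_compatUpToTwistAt_of_isLocallyFinite_source`) and FAILS at some pair with (iii) at the source
(second conjunct; `ζ ∘ χ_a : OneVertex.graph F̂₂⁽²⁾ → 𝒢_θ(2, k ↦ k+1)`, abc-iut-f-175).  Each clause needs Thm. 3.7
(iii) on its own side and only there. [cite: MochizukiSemiAnbd2006, Cor 3.9 pp.42-43] -/
theorem cor39UpToTwist_isLocallyFinite_cell_sharp :
    (¬ ∀ (𝒢 ℋ : ProfiniteSemiGraph.{0}), 𝒢.graph.IsLocallyFinite → ℋ.graph.IsLocallyFinite →
        Cor39Hypotheses 𝒢 → Cor39Hypotheses ℋ → CompactInVerticialAt ℋ →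
        ∀ (c𝒢 : TemperedPiChart 𝒢) (cℋ : TemperedPiChart ℋ) (F : Hom 𝒢 ℋ), F.IsLocallyOpen →
          ∀ φ : c𝒢.G →ₜ* cℋ.G, F.InducesUpToTwist c𝒢 cℋ φ → IsCompatiblyQuasiGeometric φ) ∧
    ¬ ∀ (𝒢 ℋ : ProfiniteSemiGraph.{0}), 𝒢.graph.IsLocallyFinite → ℋ.graph.IsLocallyFinite →
        Cor39Hypotheses 𝒢 → Cor39Hypotheses ℋ → CompactInVerticialAt 𝒢 →
        ∀ (c𝒢 : TemperedPiChart 𝒢) (cℋ : TemperedPiChart ℋ) (φ : c𝒢.G →ₜ* cℋ.G),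
          IsCompatiblyQuasiGeometric φ → ∃ F : Hom 𝒢 ℋ, F.IsLocallyOpen ∧ F.InducesUpToTwist c𝒢 cℋ φ :=
  ⟨not_forall_isLocallyFinite_cor39a, not_forall_isLocallyFinite_cor39b_of_compactInVerticialAt_source⟩

end ProfiniteSemiGraph

end Literature.AnabelianGeometry.SemiGraphs
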